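import Literature.AlgebraicGeometry.Resolution.WeightedCentreGradedAutomorphism
import Mathlib.Algebra.MvPolynomial.PDeriv
import Mathlib.LinearAlgebra.Basis.VectorSpace
import HarnessLib

/-!
# The shift vector of a block: kernel extraction (`V = 0 ⇒ S_B = 0`) and straightening (`S_B = ψ g_B - g_B`)

Uniform value line: typed theorems in the polynomial weighted-centre model `W(f)` — NOT a
resolution theorem, NOT summit progress; AI review is weaker than expert review.

Setting.  The layer equation (⋆) of the block step (`WeightedCentreLayerEquation`) reads
`Σ_{k ∈ B} S_k · ψ♭(∂ₖ F) = [H]ₘ - ψ♭ [H]ₘ` for the top block layer `F = [H]ₘ₊₁`, a form in the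
block variables.  This file types the two pieces of linear algebra the block step runs on, as
plain statements about an identity `Σ_{k ∈ B} S_k ∂ₖ F = …` (so that it does not depend on the
layer-equation file):

* **Kernel extraction** (the block below which nothing moves, `ψ♭ = id`, right-hand side `0`):
  `coeff_add_mul_of_support` (coefficient of `X^(e+f)` in a product of polynomials in disjoint
  sets of variables), `eq_zero_of_sum_mul_eq_zero` / `eq_zero_of_sum_mul_pderiv_eq_zero`
  (if `v ↦ Σ_k v_k ∂ₖ F` is injective on constant vectors — `M(0)` injective, `V = 0` — and
  `Σ_k S_k ∂ₖ F = 0` with shifts in the lower variables, then `S = 0` on the block),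
  `exists_kernel_vector_of_shift_ne_zero` (contrapositive: a block carrying a shift has `V ≠ 0`).
* **Straightening** (general right-hand side written in the block monomial basis,
  `Σ_{β ∈ R} (n_β - ψ n_β) · X^β` with block-free `n_β`): `exists_blockLeftInverse` (a `K`-linear
  left inverse `L` from injectivity on constant vectors), `shift_eq_map_sub` (every shift is the
  coboundary `S_k = ψ(g_k) - g_k` of the block-free `g_k = -Σ_β L(X^β)_k • n_β`),
  `map_sub_eq_self_of_shift` / `exists_straightening` (`ψ` fixes the straightened block
  coordinates `X_k - g_k`).
All statements are (derived here); a worked instance closes the file.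

[cite: HauserWagner2014, (T) translational move F*(y,z) = F(yz+tz,z) (arXiv p. 14–15)]
[cite: Hironaka1970AdditiveGroups, additive forms and differential operators]
[cite: AbramovichTemkinWlodarczyk2024, §5.2 (pp. 1576–1577): coordinate changes preserving the centre]
-/

open MvPolynomial Finsupp

namespace Literature.AlgebraicGeometry.Resolution.WeightedBlowup

variable {K : Type*} [Field K] {σ : Type*}

/-! ## §1 Coefficients of a product of polynomials in disjoint sets of variables -/

/-- If `S` involves only variables in `T` and `G` only variables outside `T`, then for `e`
supported in `T` and `f` supported outside `T` the coefficient of `X^(e+f)` in `S · G` is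
`coeff e S · coeff f G` (derived here; separation of the lower variables from the block and upper
ones). [cite: HauserWagner2014, (T) translational move (arXiv p. 14)] -/
theorem coeff_add_mul_of_support (T : Set σ) {S G : MvPolynomial σ K}
    (hS : ∀ d ∈ S.support, ∀ i ∈ d.support, i ∈ T)
    (hG : ∀ d ∈ G.support, ∀ i ∈ d.support, i ∉ T) {e f : σ →₀ ℕ}
    (he : ∀ i ∈ e.support, i ∈ T) (hf : ∀ i ∈ f.support, i ∉ T) :
    coeff (e + f) (S * G) = coeff e S * coeff f G := by
  classical
  rw [coeff_mul]
  have hmem : (e, f) ∈ Finset.antidiagonal (e + f) := by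
    rw [Finset.mem_antidiagonal]
  rw [Finset.sum_eq_single_of_mem (e, f) hmem]
  rintro ⟨a, b⟩ hab hne
  rw [Finset.mem_antidiagonal] at hab
  by_cases ha : coeff a S = 0
  · rw [ha, zero_mul]
  by_cases hb : coeff b G = 0
  · rw [hb, mul_zero]
  exfalso
  apply hne
  have hab' : ∀ i, a i + b i = e i + f i := fun i => by
    have h := DFunLike.congr_fun hab i
    rwa [Finsupp.add_apply, Finsupp.add_apply] at h
  have haS := hS a (MvPolynomial.mem_support_iff.mpr ha)
  have hbG := hG b (MvPolynomial.mem_support_iff.mpr hb)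
  -- values at a variable in `T`: the `G`-side exponents vanish
  have hT : ∀ i, i ∈ T → a i = e i ∧ b i = f i := by
    intro i hi
    have hb0 : b i = 0 := by
      by_contra h; exact hbG i (Finsupp.mem_support_iff.mpr h) hi
    have hf0 : f i = 0 := by
      by_contra h; exact hf i (Finsupp.mem_support_iff.mpr h) hi
    have h := hab' i
    rw [hb0, hf0, add_zero, add_zero] at h
    exact ⟨h, by rw [hb0, hf0]⟩
  -- values at a variable outside `T`: the `S`-side exponents vanish
  have hT' : ∀ i, i ∉ T → a i = e i ∧ b i = f i := by
    intro i hi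
    have ha0 : a i = 0 := by
      by_contra h; exact hi (haS i (Finsupp.mem_support_iff.mpr h))
    have he0 : e i = 0 := by
      by_contra h; exact hi (he i (Finsupp.mem_support_iff.mpr h))
    have h := hab' i
    rw [ha0, he0, zero_add, zero_add] at h
    exact ⟨by rw [ha0, he0], h⟩
  refine Prod.ext ?_ ?_
  · ext i
    by_cases hi : i ∈ T
    · exact (hT i hi).1
    · exact (hT' i hi).1
  · ext i
    by_cases hi : i ∈ T
    · exact (hT i hi).2
    · exact (hT' i hi).2

/-! ## §2 Injectivity on constant vectors forces the polynomial shift vector to vanish -/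

/-- **Kernel extraction.**  Let `G_k` (`k ∈ B`) involve only variables outside `T` and `S_k` only
variables in `T`.  If `v ↦ Σ_{k ∈ B} v_k • G_k` is injective on constant vectors (`M(0)`
injective, `V = 0`) and `Σ_{k ∈ B} S_k · G_k = 0`, then `S_k = 0` for every `k ∈ B` (derived
here: compare the coefficients of `X^(e+f)`, `e` in `T`, `f` outside; any finite index set `B`).
[cite: HauserWagner2014, (T) translational move (arXiv p. 14–15)] -/
theorem eq_zero_of_sum_mul_eq_zero {ι : Type*} (B : Finset ι) (T : Set σ)
    {S G : ι → MvPolynomial σ K}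
    (hS : ∀ k ∈ B, ∀ d ∈ (S k).support, ∀ i ∈ d.support, i ∈ T)
    (hG : ∀ k ∈ B, ∀ d ∈ (G k).support, ∀ i ∈ d.support, i ∉ T)
    (hinj : ∀ v : ι → K, (∑ k ∈ B, v k • G k) = 0 → ∀ k ∈ B, v k = 0)
    (h0 : ∑ k ∈ B, S k * G k = 0) : ∀ k ∈ B, S k = 0 := by
  classical
  intro k₀ hk₀
  ext e
  rw [coeff_zero]
  by_cases he : ∃ i ∈ e.support, i ∉ T
  · obtain ⟨i, hi, hiT⟩ := he
    by_contra h
    exact hiT (hS k₀ hk₀ e (MvPolynomial.mem_support_iff.mpr h) i hi)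
  · have he' : ∀ i ∈ e.support, i ∈ T := fun i hi => by
      by_contra h; exact he ⟨i, hi, h⟩
    -- the `e`-slice of the shift vector is a constant vector in the kernel
    refine hinj (fun k => coeff e (S k)) ?_ k₀ hk₀
    ext f
    rw [coeff_sum, coeff_zero]
    simp only [coeff_smul, smul_eq_mul]
    by_cases hf : ∃ i ∈ f.support, i ∈ T
    · obtain ⟨i, hi, hiT⟩ := hf
      refine Finset.sum_eq_zero fun k hk => ?_
      have : coeff f (G k) = 0 := by
        by_contra h
        exact hG k hk f (MvPolynomial.mem_support_iff.mpr h) i hi hiT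
      rw [this, mul_zero]
    · have hf' : ∀ i ∈ f.support, i ∉ T := fun i hi h => hf ⟨i, hi, h⟩
      have h1 : ∀ k ∈ B, coeff e (S k) * coeff f (G k) = coeff (e + f) (S k * G k) :=
        fun k hk => (coeff_add_mul_of_support T (hS k hk) (hG k hk) he' hf').symm
      rw [Finset.sum_congr rfl h1, ← coeff_sum, h0, coeff_zero]

/-- Derivatives do not introduce variables: if `F` involves no variable of `T`, neither does
`∂ₖ F` (derived here). [cite: Hironaka1970AdditiveGroups, differential operators on forms] -/
theorem support_pderiv_subset_of_support (T : Set σ) {F : MvPolynomial σ K}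
    (hF : ∀ d ∈ F.support, ∀ i ∈ d.support, i ∉ T) (k : σ) :
    ∀ d ∈ (pderiv k F).support, ∀ i ∈ d.support, i ∉ T := by
  classical
  intro d hd i hi
  rw [MvPolynomial.mem_support_iff, coeff_pderiv] at hd
  have h1 : coeff (d + Finsupp.single k 1) F ≠ 0 := fun h => hd (by rw [h, zero_mul])
  refine hF _ (MvPolynomial.mem_support_iff.mpr h1) i ?_
  rw [Finsupp.mem_support_iff] at hi ⊢
  rw [Finsupp.add_apply]
  omega

/-- **The `V = 0` extraction for the layer equation.**  If the top block layer `F` involves no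
lower variable (`T`), the shifts `S_k` involve only lower variables, `Σ_{k ∈ B} S_k · ∂ₖ F = 0`
(the layer equation (⋆) at a block below which nothing moves), and `v ↦ Σ_k v_k ∂ₖ F` is injective
on constant vectors (`V = ker M(0) = 0`), then `S_k = 0` on the block — so a block that does carry
a shift has `V ≠ 0` (derived here; the non-boundary exit of the block step).
[cite: HauserWagner2014, (T) translational move (arXiv p. 14–15)]
[cite: Hironaka1970AdditiveGroups, additive forms and differential operators] -/
theorem eq_zero_of_sum_mul_pderiv_eq_zero (B : Finset σ) (T : Set σ) {F : MvPolynomial σ K}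
    {S : σ → MvPolynomial σ K}
    (hF : ∀ d ∈ F.support, ∀ i ∈ d.support, i ∉ T)
    (hS : ∀ k ∈ B, ∀ d ∈ (S k).support, ∀ i ∈ d.support, i ∈ T)
    (hinj : ∀ v : σ → K, (∑ k ∈ B, v k • pderiv k F) = 0 → ∀ k ∈ B, v k = 0)
    (h0 : ∑ k ∈ B, S k * pderiv k F = 0) : ∀ k ∈ B, S k = 0 :=
  eq_zero_of_sum_mul_eq_zero B T hS (fun k _ => support_pderiv_subset_of_support T hF k) hinj h0

/-- Contrapositive, the form used in the block step: a nonzero shift on the block forces a nonzero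
constant kernel vector `v` with `Σ_k v_k ∂ₖ F = 0`, i.e. `V ≠ 0` (derived here).
[cite: Hironaka1970AdditiveGroups, additive forms and differential operators] -/
theorem exists_kernel_vector_of_shift_ne_zero (B : Finset σ) (T : Set σ) {F : MvPolynomial σ K}
    {S : σ → MvPolynomial σ K}
    (hF : ∀ d ∈ F.support, ∀ i ∈ d.support, i ∉ T)
    (hS : ∀ k ∈ B, ∀ d ∈ (S k).support, ∀ i ∈ d.support, i ∈ T)
    (h0 : ∑ k ∈ B, S k * pderiv k F = 0) {k₀ : σ} (hk₀ : k₀ ∈ B) (hne : S k₀ ≠ 0) :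
    ∃ v : σ → K, (∑ k ∈ B, v k • pderiv k F) = 0 ∧ ∃ k ∈ B, v k ≠ 0 := by
  by_contra hV
  refine hne (eq_zero_of_sum_mul_pderiv_eq_zero B T hF hS (fun v hv k hk => ?_) h0 k₀ hk₀)
  by_contra hvk
  exact hV ⟨v, hv, k, hk, hvk⟩

/-! ## §3 A left inverse from injectivity on constant vectors -/

/-- If `v ↦ Σ_{k ∈ B} v_k • G_k` is injective on constant vectors, there is a `K`-linear map
`L : K[X] → (ι → K)` with `L (Σ_{j ∈ B} v_j • G_j)_k = v_k` for `k ∈ B` (derived here: a left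
inverse of the injective linear map on `K^B`, extended by zero; any finite index set `B`).
[cite: AbramovichTemkinWlodarczyk2024, §5.2 (p. 1576)] -/
theorem exists_blockLeftInverse {ι : Type*} (B : Finset ι) (G : ι → MvPolynomial σ K)
    (hinj : ∀ v : ι → K, (∑ k ∈ B, v k • G k) = 0 → ∀ k ∈ B, v k = 0) :
    ∃ L : MvPolynomial σ K →ₗ[K] (ι → K),
      ∀ v : ι → K, ∀ k ∈ B, L (∑ j ∈ B, v j • G j) k = v k := by
  classical
  let Φ : (B → K) →ₗ[K] MvPolynomial σ K :=
    { toFun := fun u => ∑ j : B, u j • G j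
      map_add' := fun u u' => by
        simp only [Pi.add_apply, add_smul, Finset.sum_add_distrib]
      map_smul' := fun a u => by
        simp only [Pi.smul_apply, smul_eq_mul, RingHom.id_apply, Finset.smul_sum, smul_smul] }
  have hΦ : ∀ v : ι → K, Φ (fun j : B => v j) = ∑ j ∈ B, v j • G j := fun v => by
    show ∑ j : B, v j • G j = _
    exact Finset.sum_coe_sort B (fun j => v j • G j)
  have hker : LinearMap.ker Φ = ⊥ := by
    rw [LinearMap.ker_eq_bot']
    intro u hu
    funext j
    let v : ι → K := fun i => if h : i ∈ B then u ⟨i, h⟩ else 0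
    have hvu : (fun j : B => v j) = u := by
      funext j
      simp [v, j.2]
    have hv0 : (∑ k ∈ B, v k • G k) = 0 := by
      rw [← hΦ v, hvu]
      exact hu
    have h := hinj v hv0 j j.2
    simpa [v, j.2] using h
  obtain ⟨L', hL'⟩ := LinearMap.exists_leftInverse_of_injective Φ hker
  let E : (B → K) →ₗ[K] (ι → K) :=
    { toFun := fun u k => if h : k ∈ B then u ⟨k, h⟩ else 0
      map_add' := fun u u' => by
        funext k
        by_cases h : k ∈ B
        · simp [h]
        · simp [h]
      map_smul' := fun a u => by
        funext k
        by_cases h : k ∈ B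
        · simp [h]
        · simp [h] }
  refine ⟨E.comp L', fun v k hk => ?_⟩
  have h1 : L' (∑ j ∈ B, v j • G j) = fun j : B => v j := by
    rw [← hΦ v]
    exact LinearMap.congr_fun hL' (fun j : B => v (j : ι))
  show (if h : k ∈ B then L' (∑ j ∈ B, v j • G j) ⟨k, h⟩ else 0) = v k
  rw [dif_pos hk, h1]

/-! ## §4 The shift is a coboundary -/

/-- A combination `Σ_{β ∈ R} c_β • Q_β` of block-free polynomials is block-free. [folklore] -/
private theorem coeff_sum_smul_eq_zero {B : Finset σ} (R : Finset (σ →₀ ℕ)) (c : (σ →₀ ℕ) → K)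
    (Q : (σ →₀ ℕ) → MvPolynomial σ K)
    (hQ : ∀ β ∈ R, ∀ d ∈ (Q β).support, ∀ i ∈ d.support, i ∉ B)
    {d : σ →₀ ℕ} {i : σ} (hi : i ∈ d.support) (hiB : i ∈ B) :
    coeff d (∑ β ∈ R, c β • Q β) = 0 := by
  rw [coeff_sum]
  refine Finset.sum_eq_zero fun β hβ => ?_
  rw [coeff_smul, smul_eq_mul]
  have : coeff d (Q β) = 0 := by
    by_contra h
    exact hQ β hβ d (MvPolynomial.mem_support_iff.mpr h) i hi hiB
  rw [this, mul_zero]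

/-- Block-freeness of a difference. [folklore] -/
private theorem sub_blockFree {B : Finset σ} {P Q : MvPolynomial σ K}
    (hP : ∀ d ∈ P.support, ∀ i ∈ d.support, i ∉ B)
    (hQ : ∀ d ∈ Q.support, ∀ i ∈ d.support, i ∉ B) :
    ∀ d ∈ (P - Q).support, ∀ i ∈ d.support, i ∉ B := by
  intro d hd i hi hiB
  rw [MvPolynomial.mem_support_iff, coeff_sub] at hd
  by_cases h1 : coeff d P = 0
  · have h2 : coeff d Q ≠ 0 := fun h => hd (by rw [h1, h, sub_zero])
    exact hQ d (MvPolynomial.mem_support_iff.mpr h2) i hi hiB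
  · exact hP d (MvPolynomial.mem_support_iff.mpr h1) i hi hiB

/-- **Straightening (the `V = 0` branch of the block step).**  Let `F` be a polynomial in the
block variables `B` only, `L` a left inverse of `v ↦ Σ_j v_j ∂ⱼ F` on constant vectors, `R` a
finite set of block exponents, `n_β` (`β ∈ R`) and `ψ (n_β)` free of block variables, and `S_k`
(`k ∈ B`) free of block variables.  If
`Σ_{k ∈ B} S_k ∂ₖ F = Σ_{β ∈ R} (n_β - ψ n_β) · X^β` (the layer equation in the block basis), then
for every `k ∈ B`, with `g_k := -Σ_{β ∈ R} L(X^β)_k • n_β`,  `S_k = ψ (g_k) - g_k` (derived here: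
compare the coefficients of `X^(e+f)`, `e` block-free, `f` a block monomial, and apply `L`).
[cite: HauserWagner2014, (T) translational move (arXiv p. 14–15)] -/
theorem shift_eq_map_sub (B : Finset σ) {F : MvPolynomial σ K}
    (hF : ∀ d ∈ F.support, ∀ i ∈ d.support, i ∈ B)
    (L : MvPolynomial σ K →ₗ[K] (σ → K))
    (hL : ∀ v : σ → K, ∀ k ∈ B, L (∑ j ∈ B, v j • pderiv j F) k = v k)
    (R : Finset (σ →₀ ℕ)) (hR : ∀ β ∈ R, ∀ i ∈ β.support, i ∈ B)
    (n : (σ →₀ ℕ) → MvPolynomial σ K)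
    (hn : ∀ β ∈ R, ∀ d ∈ (n β).support, ∀ i ∈ d.support, i ∉ B)
    (ψ : MvPolynomial σ K →ₐ[K] MvPolynomial σ K)
    (hψn : ∀ β ∈ R, ∀ d ∈ (ψ (n β)).support, ∀ i ∈ d.support, i ∉ B)
    {S : σ → MvPolynomial σ K}
    (hS : ∀ k ∈ B, ∀ d ∈ (S k).support, ∀ i ∈ d.support, i ∉ B)
    (hstar : ∑ k ∈ B, S k * pderiv k F = ∑ β ∈ R, (n β - ψ (n β)) * monomial β 1)
    {k : σ} (hk : k ∈ B) :
    S k = ψ (-∑ β ∈ R, L (monomial β 1) k • n β) - (-∑ β ∈ R, L (monomial β 1) k • n β) := by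
  classical
  -- the right-hand side is `Σ_β L(X^β)_k • (n_β - ψ n_β)`
  have hrhs : ψ (-∑ β ∈ R, L (monomial β 1) k • n β) - (-∑ β ∈ R, L (monomial β 1) k • n β)
      = ∑ β ∈ R, L (monomial β 1) k • (n β - ψ (n β)) := by
    rw [map_neg, map_sum, sub_neg_eq_add, neg_add_eq_sub, ← Finset.sum_sub_distrib]
    refine Finset.sum_congr rfl fun β _ => ?_
    rw [map_smul, smul_sub]
  rw [hrhs]
  -- the set of "lower" variables is the complement of the block
  set T : Set σ := {i | i ∉ B} with hT
  have hS' : ∀ j ∈ B, ∀ d ∈ (S j).support, ∀ i ∈ d.support, i ∈ T :=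
    fun j hj d hd i hi => hS j hj d hd i hi
  have hdF : ∀ j, ∀ d ∈ (pderiv j F).support, ∀ i ∈ d.support, i ∉ T :=
    fun j => support_pderiv_subset_of_support T (fun d hd i hi h => h (hF d hd i hi)) j
  have hδ : ∀ β ∈ R, ∀ d ∈ (n β - ψ (n β)).support, ∀ i ∈ d.support, i ∈ T :=
    fun β hβ => sub_blockFree (hn β hβ) (hψn β hβ)
  have hmon : ∀ β ∈ R, ∀ d ∈ (monomial β (1 : K)).support, ∀ i ∈ d.support, i ∉ T := by
    intro β hβ d hd i hi h
    have hd' : d = β := Finset.mem_singleton.mp (support_monomial_subset hd)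
    subst hd'
    exact h (hR d hβ i hi)
  ext d
  by_cases hd : ∃ i ∈ d.support, i ∈ B
  · -- a monomial touching the block: both sides vanish
    obtain ⟨i, hi, hiB⟩ := hd
    have h1 : coeff d (S k) = 0 := by
      by_contra h
      exact hS k hk d (MvPolynomial.mem_support_iff.mpr h) i hi hiB
    rw [h1, coeff_sum_smul_eq_zero R _ _ (fun β hβ => sub_blockFree (hn β hβ) (hψn β hβ)) hi hiB]
  · -- a block-free monomial `e := d`: compare the `e`-slices
    have he : ∀ i ∈ d.support, i ∈ T := fun i hi h => hd ⟨i, hi, h⟩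
    -- the `e`-slice of the shift vector
    set c : σ → K := fun j => coeff d (S j) with hc
    have hslice : (∑ j ∈ B, c j • pderiv j F)
        = ∑ β ∈ R, coeff d (n β - ψ (n β)) • monomial β 1 := by
      ext f
      rw [coeff_sum, coeff_sum]
      simp only [coeff_smul, smul_eq_mul]
      by_cases hf : ∃ i ∈ f.support, i ∉ B
      · -- `f` is not a block monomial: every term vanishes on both sides
        obtain ⟨i, hi, hiB⟩ := hf
        have hl : ∀ j ∈ B, c j * coeff f (pderiv j F) = 0 := by
          intro j _
          have : coeff f (pderiv j F) = 0 := by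
            by_contra h
            exact hdF j f (MvPolynomial.mem_support_iff.mpr h) i hi hiB
          rw [this, mul_zero]
        have hr : ∀ β ∈ R, coeff d (n β - ψ (n β)) * coeff f (monomial β 1) = 0 := by
          intro β hβ
          have : coeff f (monomial β (1 : K)) = 0 := by
            rw [coeff_monomial, if_neg]
            intro hβf
            rw [← hβf] at hi
            exact hiB (hR β hβ i hi)
          rw [this, mul_zero]
        rw [Finset.sum_congr rfl hl, Finset.sum_congr rfl hr, Finset.sum_const_zero,
          Finset.sum_const_zero]
      · have hf' : ∀ i ∈ f.support, i ∉ T := fun i hi h => hf ⟨i, hi, h⟩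
        have hl : ∀ j ∈ B, c j * coeff f (pderiv j F) = coeff (d + f) (S j * pderiv j F) :=
          fun j hj => (coeff_add_mul_of_support T (hS' j hj) (hdF j) he hf').symm
        have hr : ∀ β ∈ R, coeff d (n β - ψ (n β)) * coeff f (monomial β 1)
            = coeff (d + f) ((n β - ψ (n β)) * monomial β 1) :=
          fun β hβ => (coeff_add_mul_of_support T (hδ β hβ) (hmon β hβ) he hf').symm
        rw [Finset.sum_congr rfl hl, Finset.sum_congr rfl hr, ← coeff_sum, ← coeff_sum, hstar]
    -- apply the left inverse at `k`
    have happly := hL c k hk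
    rw [hslice, map_sum] at happly
    simp only [map_smul, Finset.sum_apply, Pi.smul_apply, smul_eq_mul] at happly
    -- `happly : Σ_β coeff d (n β - ψ n β) * L (X^β) k = c k`
    rw [show coeff d (S k) = c k from rfl, ← happly, coeff_sum]
    refine Finset.sum_congr rfl fun β _ => ?_
    rw [coeff_smul, smul_eq_mul, mul_comm]

/-! ## §5 The straightened coordinate is fixed -/

/-- If `ψ (X_k) = X_k + S_k` and `S_k = ψ (g_k) - g_k`, then `ψ` fixes the straightened coordinate
`X_k - g_k` (derived here). [cite: AbramovichTemkinWlodarczyk2024, §5.2 (pp. 1576–1577)] -/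
theorem map_sub_eq_self_of_shift (ψ : MvPolynomial σ K →ₐ[K] MvPolynomial σ K) {k : σ}
    {Sk g : MvPolynomial σ K} (hX : ψ (X k) = X k + Sk) (hS : Sk = ψ g - g) :
    ψ (X k - g) = X k - g := by
  rw [map_sub, hX, hS]
  ring

/-- **Straightening, assembled.**  Under the hypotheses of `shift_eq_map_sub` and
`ψ (X_k) = X_k + S_k` on the block, with `M(0)` injective on constant vectors, there are
block-free `g_k` (`k ∈ B`) such that `ψ` fixes every `X_k - g_k` (derived here: in the straightened
block coordinates the block no longer moves).
[cite: HauserWagner2014, (T) translational move (arXiv p. 14–15)]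
[cite: AbramovichTemkinWlodarczyk2024, §5.2 (pp. 1576–1577)] -/
theorem exists_straightening (B : Finset σ) {F : MvPolynomial σ K}
    (hF : ∀ d ∈ F.support, ∀ i ∈ d.support, i ∈ B)
    (hinj : ∀ v : σ → K, (∑ k ∈ B, v k • pderiv k F) = 0 → ∀ k ∈ B, v k = 0)
    (R : Finset (σ →₀ ℕ)) (hR : ∀ β ∈ R, ∀ i ∈ β.support, i ∈ B)
    (n : (σ →₀ ℕ) → MvPolynomial σ K)
    (hn : ∀ β ∈ R, ∀ d ∈ (n β).support, ∀ i ∈ d.support, i ∉ B)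
    (ψ : MvPolynomial σ K →ₐ[K] MvPolynomial σ K)
    (hψn : ∀ β ∈ R, ∀ d ∈ (ψ (n β)).support, ∀ i ∈ d.support, i ∉ B)
    {S : σ → MvPolynomial σ K}
    (hS : ∀ k ∈ B, ∀ d ∈ (S k).support, ∀ i ∈ d.support, i ∉ B)
    (hX : ∀ k ∈ B, ψ (X k) = X k + S k)
    (hstar : ∑ k ∈ B, S k * pderiv k F = ∑ β ∈ R, (n β - ψ (n β)) * monomial β 1) :
    ∃ g : σ → MvPolynomial σ K,
      (∀ k ∈ B, ∀ d ∈ (g k).support, ∀ i ∈ d.support, i ∉ B) ∧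
      (∀ k ∈ B, S k = ψ (g k) - g k) ∧
      (∀ k ∈ B, ψ (X k - g k) = X k - g k) := by
  classical
  obtain ⟨L, hL⟩ := exists_blockLeftInverse B (fun j => pderiv j F) hinj
  refine ⟨fun k => -∑ β ∈ R, L (monomial β 1) k • n β, fun k _ => ?_, fun k hk => ?_, fun k hk => ?_⟩
  · intro d hd i hi hiB
    rw [MvPolynomial.mem_support_iff, coeff_neg, neg_ne_zero] at hd
    exact hd (coeff_sum_smul_eq_zero R _ n hn hi hiB)
  · exact shift_eq_map_sub B hF L hL R hR n hn ψ hψn hS hstar hk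
  · exact map_sub_eq_self_of_shift ψ (hX k hk) (shift_eq_map_sub B hF L hL R hR n hn ψ hψn hS hstar hk)

/-! ## §6 A worked instance -/

section Instance

/-- `K[X₀, X₁, X₂]`, block `B = {0, 1}`, lower variables `T = {2}`, top form `F = X₀ X₁`:
`v ↦ v₀ ∂₀F + v₁ ∂₁F = v₀ X₁ + v₁ X₀` is injective, so any lower shifts with
`S₀ X₁ + S₁ X₀ = 0` vanish. [folklore] -/
example {S : Fin 3 → MvPolynomial (Fin 3) K}
    (hS : ∀ k ∈ ({0, 1} : Finset (Fin 3)), ∀ d ∈ (S k).support, ∀ i ∈ d.support,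
      i ∈ ({2} : Set (Fin 3)))
    (h0 : ∑ k ∈ ({0, 1} : Finset (Fin 3)), S k * pderiv k (X 0 * X 1 : MvPolynomial (Fin 3) K) = 0) :
    S 0 = 0 ∧ S 1 = 0 := by
  have hF : ∀ d ∈ (X 0 * X 1 : MvPolynomial (Fin 3) K).support, ∀ i ∈ d.support,
      i ∉ ({2} : Set (Fin 3)) := by
    intro d hd i hi
    have hX : (X 0 * X 1 : MvPolynomial (Fin 3) K) =
        monomial (Finsupp.single 0 1 + Finsupp.single 1 1) 1 := by
      rw [X, X, monomial_mul, mul_one]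
    rw [hX] at hd
    have hd' := Finset.mem_singleton.mp (support_monomial_subset hd)
    subst hd'
    rw [Finsupp.mem_support_iff, Finsupp.add_apply, Finsupp.single_apply, Finsupp.single_apply] at hi
    rw [Set.mem_singleton_iff]
    intro h; subst h
    simp at hi
  have hinj : ∀ v : Fin 3 → K,
      (∑ k ∈ ({0, 1} : Finset (Fin 3)), v k • pderiv k (X 0 * X 1 : MvPolynomial (Fin 3) K)) = 0 →
        ∀ k ∈ ({0, 1} : Finset (Fin 3)), v k = 0 := by
    intro v hv k hk
    have hsum : (∑ k ∈ ({0, 1} : Finset (Fin 3)), v k • pderiv k (X 0 * X 1 : MvPolynomial (Fin 3) K))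
        = v 0 • X 1 + v 1 • X 0 := by
      rw [Finset.sum_pair (by decide)]
      simp
    rw [hsum] at hv
    have h1 : v 0 = 0 := by
      have := congrArg (coeff (Finsupp.single 1 1)) hv
      simpa [X, coeff_monomial, Finsupp.single_eq_single_iff] using this
    have h2 : v 1 = 0 := by
      have := congrArg (coeff (Finsupp.single 0 1)) hv
      simpa [X, coeff_monomial, Finsupp.single_eq_single_iff] using this
    simp only [Finset.mem_insert, Finset.mem_singleton] at hk
    rcases hk with rfl | rfl
    exacts [h1, h2]
  have h := eq_zero_of_sum_mul_pderiv_eq_zero ({0, 1} : Finset (Fin 3)) ({2} : Set (Fin 3)) hF hS hinj h0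
  exact ⟨h 0 (by simp), h 1 (by simp)⟩

end Instance

end Literature.AlgebraicGeometry.Resolution.WeightedBlowup
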